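import Mathlib
import Summits.Langlands.Langlands.Theses.PhantomRMYoshida
import Summits.Langlands.Langlands.Theorems.PhantomRMYoshidaStableYoshidaCongruenceSector
import Summits.Langlands.Langlands.Theorems.PhantomRMYoshidaStableYoshidaCongruenceBWSector
import Summits.Langlands.Langlands.Theorems.PhantomRMYoshidaStableYoshidaCongruenceModFaltingsResidue
import Summits.Langlands.Langlands.Theorems.PhantomRMYoshidaFaltingsTateModuleQGate
import Literature.NumberTheory.GaloisRepresentations.SerreWeight
import Literature.NumberTheory.GaloisRepresentations.ResidualPair
import Literature.NumberTheory.DiophantineGeometry.AbelianVarietyOrdinaryReduction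
import Literature.AlgebraicGeometry.Motives.FaltingsAbelian
import Literature.AlgebraicGeometry.Motives.FaltingsFinitenessI
import Summits.Langlands.Langlands.Theorems.PhantomRMYoshidaStableYoshidaCongruenceSemistableGreenberg
import Literature.NumberTheory.DiophantineGeometry.BcgpSwitchExistsModularAbelianSurfaceProofs
import HarnessLib

/-!
# Route `PhantomRMYoshida`, crux `StableYoshidaCongruence` (stmt-Langlands-13640), line
# `semistable-three-adic-anchor`: the SEMISTABLE SECTOR THEOREM modulo the lever, and the lever from a purely
# arithmetic-geometric supply + BCGP Thm. 8.3.2 (stubs `stub_semistableSectorModuloLever`, `stub_tresRamifieSwitchOfSupply`)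

Registered reshape stubs of the line `semistable-three-adic-anchor` (planner crux-plan round 2, checked skeleton
`Cruxes/StableYoshidaCongruence/Lines/semistable_three_adic_anchor.lean`; lead a2 reshapes 1–2), proved here from landed
material only (the first bullet's stub lives in the sibling file `…SemistableGreenberg.lean`, p128873):

* `stub_greenbergOfOrdinaryFiltration` — for an abelian surface `B/ℚ`, a `ℚ_p`-basis `b` of `V_p B` and its framed `H¹`
  `ρ₀` (`TateFrame`), if `V_p(B)` is ORDINARY-FILTERED at `v ∣ p` (`IsOrdinaryFilteredAt`, copied verbatim from the
  skeleton: a `Γ_{ℚ_v}`-stable plane `W` with inertia `= χ_p` on `W` and trivial on `V/W` — verbatim the conclusion of the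
  Serre–Tate fact `ordinaryReduction_tateModule_filtration` at `K = ℚ`, but also the output format of SEMISTABLE ordinary
  reduction) then `ρ₀` is Greenberg-ordinary of shape `(0,0,1,1)` at `v`.  The proof is the landed proof of
  `…LevelThreeWeierstrassSwitch.stub_tateModuleGreenberg` (Theorems/…TateModuleGreenberg.lean) from its second line on —
  dualise the filtration in an adapted basis, triangularise the two commuting `2 × 2` block families over `ℚ̄_p` — with the
  filtration taken as a HYPOTHESIS instead of being obtained from Serre–Tate + good reduction.  This decouples the
  Greenberg dictionary from good reduction (the semistable line's point) and is reusable by every motivic sector.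
* `stub_semistableSectorModuloLever` — the `p = 3` SEMISTABLE SECTOR THEOREM: granted the four published facts of the
  Burkhardt–Weddle sector theorem (`FaltingsFinitenessI` = route gate item stmt-Langlands-15084, Serre–Tate, the printed
  BCGP `2`–`3` switch `bcgp_switch_exists_modular_abelianSurface`, the Weil pairing — same interface and order as the landed
  `stub_bwSectorModuloFacts`, p117182) and granted THE LEVER of the line (the statement `TresRamifieSwitch` of its registered
  stub `stub_tresRamifieSwitch`, inlined verbatim as the fifth hypothesis: the semistable sibling of BCGP Lemma 9.4.2 for
  Yoshida-type `ρ̄` with a TRÈS RAMIFIÉ block at `3`, output keyed to the ordinary filtration — NOT in print, hence not a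
  Literature fact), the crux holds at every datum of the SEMISTABLE SECTOR (inlined: `p = 3`, `charpoly σ · charpoly σ'`
  `𝔽₃`-rational, unramified at `2` with `P₁ P₂ ≠ (X² ± X + 2)²`; NOTHING assumed at `3`).  Proof = the skeleton's
  sorry-free chain: `semistableSwitchable_of_sector` (landed BW stubs `stub_modelFp`, `stub_symplecticFormFp`,
  `stub_localConditionsTransfer`, `stub_residualLattice`, `stub_ordinaryFrameFp`: the ordinary SHAPE at `3` is derived from
  the crux's H5-witness), the case split peu/très ramifié (`bcgp_switch_exists_modular_abelianSurface` + Serre–Tate, resp. the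
  lever), then the framed `H¹` dictionary (`framedH1`, `isSymplectic_framedH1`, `hasResidualPair_of_congruence`,
  `stub_tateModuleIrreducible_of` via `faltings_tate_bijective_of_finitenessI` /
  `isSemisimpleRepresentation_rationalTateRep_of_finitenessI`, `stub_greenbergOfOrdinaryFiltration`,
  `stub_charpolyCongruence` + `stub_distinguishedTransferLocal`, automorphy from the switch).
* `stub_tresRamifieSwitchOfSupply` — THE LEVER `TresRamifieSwitch` itself from (i) the tree's named fact
  `bcgp_residuallyA5b_modular_abelianSurface` (BCGP 2025 Thm. 8.3.2, `GL₄` form; hypotheses at `2` and `∞` only, so a surface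
  semistable at `3` qualifies) and (ii) the purely arithmetic-geometric TRÈS-RAMIFIÉ SUPPLY (the line's remaining unprinted stub
  `stub_tresRamifieSupply`, inlined: for the très-ramifié Yoshida-type `ρ̄` an abelian surface `B/ℚ` with (a) `ρ̄_{B,3} ≅ ρ̄` as a
  frame of `B[3](ℚ̄)`, (b) semistable-or-good ordinary `2`-distinguished reduction at `2`, (c′) `V₃(B)` ordinary-filtered at `3`,
  (d) `im ρ̄_{B,2} = S₅(b)` — the binder `h₁` of `bcgp_switch_exists_modular_abelianSurface_of_lemma942abcd_of_theorem832` with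
  (c) ↦ (c′)); proof as Part 11/13 there: End clause from (d) (`AbelianVariety.forall_end_eq_zsmul_id_of_s5bFrame`), congruence
  from (a) (`bcgp_switch_charpolyClause`), automorphy from Thm. 8.3.2 at `p = 3`.

`IsOrdinaryShapedAt` and `IsOrdinaryFilteredAt` are copied VERBATIM from the checked skeleton so that the registered
signatures elaborate identically; everything else is imported (LTWS: `IsModelOf`, `IsSwitchableAtTwo`, `TateFrame`,
`EndTrivial`, `epsBar`, `DetCond`, `CruxAt`, `AutGL4`, `Sh`; BW: the transfer stubs).  Lead prover-line-stmt-Langlands-13640-a2-0,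
2026-08-16.
-/

set_option linter.dupNamespace false

noncomputable section

open CategoryTheory IsDedekindDomain Polynomial
open scoped NumberField commutatorElement Matrix
open Literature.NumberTheory.GaloisRepresentations Literature.NumberTheory.Automorphic
open Literature.AlgebraicGeometry.Motives (AbelianVariety)
open Literature.NumberTheory.DiophantineGeometry (weilPairing_rationalTateModule
  ordinaryReduction_tateModule_filtration bcgp_switch_exists_modular_abelianSurface
  bcgp_residuallyA5b_modular_abelianSurface bcgp_switch_charpolyClause s5bMatrix)
open Summit.Langlands.Langlands.Theses.PhantomRMYoshida
open Summit.Langlands.Langlands.Theorems.PhantomRMYoshida (faltings_tate_bijective_of_finitenessI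
  isSemisimpleRepresentation_rationalTateRep_of_finitenessI)
open Summit.Langlands.Langlands.Cruxes.StableYoshidaCongruence.LevelThreeWeierstrassSwitch
open Summit.Langlands.Langlands.Cruxes.StableYoshidaCongruence.BurkhardtWeddleTwoThreeAnchor

namespace Summit.Langlands.Langlands.Cruxes.StableYoshidaCongruence.SemistableThreeAdicAnchor

/-! ## Vocabulary (verbatim from the checked skeleton) -/

section Vocabulary

variable (p : ℕ) [Fact p.Prime] (k : Type) [Field k] [CharP k p] [TopologicalSpace k] [DiscreteTopology k]

variable {k} in
/-- `IsOrdinaryShapedAt p v ρb` (`v ∣ p`): `ρb|_{Γ_{ℚ_v}}` is ORDINARY-SHAPED — block upper-triangular in some `𝔽_p`-frame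
with inertia trivial on the first `2 × 2` block and the scalar `ε̄⁻¹` on the second ("`ρb^∨|_{G_{ℚ_p}}` ordinary",
arXiv:2502.20645 Cor. 9.3.5) — with NO flatness / peu-ramifié condition: verbatim the frame conjunct of the landed
`IsOrdinaryFlatAt` (= the output of the landed `stub_ordinaryFrameFp`), its `IsPeuRamifie` conjunct deleted.  Très ramifié
extension classes (Kummer classes of non-units; Serre 1987 §2.4) are allowed. -/
def IsOrdinaryShapedAt (v : HeightOneSpectrum (𝓞 ℚ)) (ρb : FramedGaloisRep ℚ (ZMod p) 4) : Prop :=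
  ∃ g : GL (Fin 4) (ZMod p),
    (∀ (τ : Field.absoluteGaloisGroup (v.adicCompletion ℚ)) (i j : Fin 4), 2 ≤ (i : ℕ) → (j : ℕ) < 2 →
        (g * ρb.toLocal v τ * g⁻¹).val i j = 0) ∧
    (∀ τ ∈ absInertia (v.adicCompletion ℚ), ∀ i j : Fin 4, (i : ℕ) < 2 → (j : ℕ) < 2 →
        (g * ρb.toLocal v τ * g⁻¹).val i j = if i = j then 1 else 0) ∧
    (∀ τ ∈ absInertia (v.adicCompletion ℚ), ∀ i j : Fin 4, 2 ≤ (i : ℕ) → 2 ≤ (j : ℕ) →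
        (g * ρb.toLocal v τ * g⁻¹).val i j =
          if i = j then (((epsBar p (absGaloisRestrict ℚ (v.adicCompletion ℚ) τ))⁻¹ : (ZMod p)ˣ) : ZMod p)
          else 0)

end Vocabulary

/-! ## The sector's input, DERIVED from the crux's hypotheses (landed BW stubs; nothing 3-adic assumed) -/

/-- **The semistable sector delivers a switchable model** (the skeleton's `semistableSwitchable_of_sector`, conclusion
`SemistableSwitchable` unfolded): given the crux's hypotheses H2–H5 at data with `𝔽_p`-rational `charpoly σ · charpoly σ'`
and the 2-adic clause, `σ ⊕ σ'` has a symplectic-`ε̄⁻¹` `GSp₄(𝔽_p)`-model (`stub_modelFp`, `stub_symplecticFormFp`),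
ORDINARY-SHAPED at `p` by H5 (`stub_residualLattice` + `stub_ordinaryFrameFp`) and switchable at `2`
(`stub_localConditionsTransfer`, second half). [cite: BoxerCalegariGeePilloni2025, Lemma 9.4.2, Cor. 9.3.5 (arXiv:2502.20645)] -/
theorem exists_semistableSwitchable_model (p : ℕ) [Fact p.Prime] (hp : p ≠ 2) (k : Type) [Field k] [CharP k p]
    [IsAlgClosed k] [TopologicalSpace k] [DiscreteTopology k] (red : Valued.integer (PadicAlgCl p) →+* k)
    (σ σ' : FramedGaloisRep ℚ k 2)
    (hrat : ∀ g : Field.absoluteGaloisGroup ℚ, ∃ Q : Polynomial (ZMod p),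
      Q.map (ZMod.castHom (dvd_refl p) k) = FramedRep.charpoly σ g * FramedRep.charpoly σ' g)
    (htwo : ∀ v : HeightOneSpectrum (𝓞 ℚ), ((2 : ℕ) : 𝓞 ℚ) ∈ v.asIdeal →
      σ.IsUnramifiedAt v ∧ σ'.IsUnramifiedAt v ∧
      ∃ P₁ P₂ : Polynomial k, σ.HasFrobCharpolyAt v P₁ ∧ σ'.HasFrobCharpolyAt v P₂ ∧
        P₁ * P₂ ≠ (X ^ 2 + X + C 2) ^ 2 ∧ P₁ * P₂ ≠ (X ^ 2 - X + C 2) ^ 2)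
    (hirr : σ.toGaloisRep.IsIrreducible) (hirr' : σ'.toGaloisRep.IsIrreducible) (hdet : DetCond p σ σ')
    (hnc : NonConj σ σ') (hw : ∃ ρ : FramedGaloisRep ℚ (PadicAlgCl p) 4, Sh red σ σ' ρ) :
    ∃ ρb : FramedGaloisRep ℚ (ZMod p) 4,
      ρb.IsSymplecticWithMultiplierFun (fun g => (((epsBar p g)⁻¹ : (ZMod p)ˣ) : ZMod p)) ∧
      IsModelOf ρb σ σ' ∧
      (∀ v : HeightOneSpectrum (𝓞 ℚ), ((p : ℕ) : 𝓞 ℚ) ∈ v.asIdeal → IsOrdinaryShapedAt p v ρb) ∧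
      (∀ v : HeightOneSpectrum (𝓞 ℚ), ((2 : ℕ) : 𝓞 ℚ) ∈ v.asIdeal → IsSwitchableAtTwo p v ρb) := by
  obtain ⟨ρw, -, hloc, hpair⟩ := hw
  obtain ⟨ρb, hmodel⟩ := stub_modelFp p k σ σ' hirr hirr' hrat
  have hsymp := stub_symplecticFormFp p hp k σ σ' ρb hirr hirr' hdet hnc hmodel
  obtain ⟨-, htwoT⟩ := stub_localConditionsTransfer p k σ σ' ρb hmodel
  refine ⟨ρb, hsymp, hmodel, fun v hv => ?_, fun v hv => ?_⟩
  · obtain ⟨M, hM1, hM2, hM3, -⟩ :=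
      stub_residualLattice p hp k red σ σ' ρw v hv (hloc v hv).1 (hloc v hv).2 hpair
    exact stub_ordinaryFrameFp p hp k σ σ' ρb M v hv hirr hirr' hdet hmodel hM1 hM2 hM3
  · obtain ⟨hσ, hσ', hP⟩ := htwo v hv
    exact htwoT v hσ hσ' hP

/-! ## The lever from a purely arithmetic-geometric SUPPLY and BCGP Thm. 8.3.2 (registered stub `stub_tresRamifieSwitchOfSupply`) -/

/-- **The lever `TresRamifieSwitch` from the très-ramifié SUPPLY and BCGP Thm. 8.3.2** (registered reshape stub
`stub_tresRamifieSwitchOfSupply` of the line `semistable-three-adic-anchor`; the planner's "first reshape" of its lever).  Hypotheses: the named fact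
`bcgp_residuallyA5b_modular_abelianSurface` (arXiv:2502.20645 Thm. 8.3.2, `GL₄` form; hypotheses at `2` and `∞` only) and the
très-ramifié supply (inlined; NOT in print).  Conclusion: verbatim the body of the line's `TresRamifieSwitch` — an abelian
surface `B/ℚ` of dimension `2` with `V₃(B)` ordinary-filtered at `3`, `End_ℚ(B) = ℤ · 𝟙` (`EndTrivial`), whose framed
`H¹ = (V₃ B)^∨ ⊗ ℚ̄₃` (`TateFrame`) has `ℤ₃`-integral characteristic polynomials reducing to those of `ρ̄`, MODULAR (`AutGL4`).
Proof as in Part 11 of `BcgpSwitchExistsModularAbelianSurfaceProofs.lean`: End clause from (d) by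
`AbelianVariety.forall_end_eq_zsmul_id_of_s5bFrame`, congruence clause from (a) by `bcgp_switch_charpolyClause`, automorphy from
Thm. 8.3.2 at `p = 3` fed with (b) and (d).
[cite: BoxerCalegariGeePilloni2025, Thm. 8.3.2 with Remark 1.8.9, §1.8.10, Def. 1.8.12; Lemma 9.4.2 (2)(a)–(d); §1.8.11; Lemma 8.1.1 (arXiv:2502.20645)]
[cite: Zarhin2000, §3 and §1] -/
theorem stub_tresRamifieSwitchOfSupply :
    bcgp_residuallyA5b_modular_abelianSurface →
    (∀ (k : Type) [Field k] [CharP k 3] [IsAlgClosed k] [TopologicalSpace k] [DiscreteTopology k]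
    (σ σ' : FramedGaloisRep ℚ k 2) (ρb : FramedGaloisRep ℚ (ZMod 3) 4),
    IsModelOf ρb σ σ' → DetCond 3 σ σ' →
    ρb.IsSymplecticWithMultiplierFun (fun g => (((epsBar 3 g)⁻¹ : (ZMod 3)ˣ) : ZMod 3)) →
    (∀ v : HeightOneSpectrum (𝓞 ℚ), ((3 : ℕ) : 𝓞 ℚ) ∈ v.asIdeal → IsOrdinaryShapedAt 3 v ρb) →
    ¬ (∀ v : HeightOneSpectrum (𝓞 ℚ), ((3 : ℕ) : 𝓞 ℚ) ∈ v.asIdeal → ModPGaloisRep.IsPeuRamifie (ρb.toLocal v)) →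
    (∀ v : HeightOneSpectrum (𝓞 ℚ), ((2 : ℕ) : 𝓞 ℚ) ∈ v.asIdeal → IsSwitchableAtTwo 3 v ρb) →
    ∃ B : AbelianVariety ℚ,
      B.dim = 2 ∧
      (∃ e₃ : B.geomTorsion (3 : ℕ) ≃+ (Fin 4 → ZMod 3),
        ∀ (g : Field.absoluteGaloisGroup ℚ) (P : B.geomTorsion (3 : ℕ)),
          e₃ (g • P) = ((ρb g⁻¹ : GL (Fin 4) (ZMod 3)) : Matrix (Fin 4) (Fin 4) (ZMod 3))ᵀ *ᵥ e₃ P) ∧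
      (∀ (ℓ : ℕ) [Fact ℓ.Prime], ℓ ≠ 2 →
        ∀ v : HeightOneSpectrum (𝓞 ℚ), ((2 : ℕ) : 𝓞 ℚ) ∈ v.asIdeal →
          ∀ τ ∈ absInertia (v.adicCompletion ℚ),
            (B.rationalTateRep ℓ (absGaloisRestrict ℚ (v.adicCompletion ℚ) τ) - 1) ^ 2 = 0) ∧
      (∀ (b₂ : Module.Basis (Fin 4) ℚ_[2] (B.rationalTateModule 2)) (r₂ : FramedGaloisRep ℚ (PadicAlgCl 2) 4),
        (∀ g : Field.absoluteGaloisGroup ℚ,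
          (r₂ g).val =
            ((LinearMap.toMatrix b₂ b₂ (B.rationalTateRep 2 g⁻¹)).map (algebraMap ℚ_[2] (PadicAlgCl 2))).transpose) →
        ∀ v : HeightOneSpectrum (𝓞 ℚ), ((2 : ℕ) : 𝓞 ℚ) ∈ v.asIdeal → r₂.IsOrdinaryPDistinguishedAt v) ∧
      (∀ v : HeightOneSpectrum (𝓞 ℚ), ((3 : ℕ) : 𝓞 ℚ) ∈ v.asIdeal → IsOrdinaryFilteredAt 3 B v) ∧
      (∃ e₂ : B.geomTorsion (2 : ℕ) ≃+ (Fin 4 → ZMod 2),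
        (∀ g : Field.absoluteGaloisGroup ℚ, ∃ w : Equiv.Perm (Fin 5),
          ∀ P : B.geomTorsion (2 : ℕ), e₂ (g • P) = s5bMatrix w *ᵥ e₂ P) ∧
        (∀ w : Equiv.Perm (Fin 5), ∃ g : Field.absoluteGaloisGroup ℚ,
          ∀ P : B.geomTorsion (2 : ℕ), e₂ (g • P) = s5bMatrix w *ᵥ e₂ P) ∧
        (∀ c : Field.absoluteGaloisGroup ℚ, IsComplexConjugation (algebraMap ℚ ℝ) c →
          ∃ w : Equiv.Perm (Fin 5), w.cycleType = {2, 2} ∧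
            ∀ P : B.geomTorsion (2 : ℕ), e₂ (c • P) = s5bMatrix w *ᵥ e₂ P))) →
  ∀ (k : Type) [Field k] [CharP k 3] [IsAlgClosed k] [TopologicalSpace k] [DiscreteTopology k]
    (σ σ' : FramedGaloisRep ℚ k 2) (ρb : FramedGaloisRep ℚ (ZMod 3) 4),
    IsModelOf ρb σ σ' → DetCond 3 σ σ' →
    ρb.IsSymplecticWithMultiplierFun (fun g => (((epsBar 3 g)⁻¹ : (ZMod 3)ˣ) : ZMod 3)) →
    (∀ v : HeightOneSpectrum (𝓞 ℚ), ((3 : ℕ) : 𝓞 ℚ) ∈ v.asIdeal → IsOrdinaryShapedAt 3 v ρb) →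
    ¬ (∀ v : HeightOneSpectrum (𝓞 ℚ), ((3 : ℕ) : 𝓞 ℚ) ∈ v.asIdeal → ModPGaloisRep.IsPeuRamifie (ρb.toLocal v)) →
    (∀ v : HeightOneSpectrum (𝓞 ℚ), ((2 : ℕ) : 𝓞 ℚ) ∈ v.asIdeal → IsSwitchableAtTwo 3 v ρb) →
    ∃ B : AbelianVariety ℚ,
      B.dim = 2 ∧
      (∀ v : HeightOneSpectrum (𝓞 ℚ), ((3 : ℕ) : 𝓞 ℚ) ∈ v.asIdeal → IsOrdinaryFilteredAt 3 B v) ∧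
      EndTrivial B ∧
      ∀ (b : Module.Basis (Fin 4) ℚ_[3] (B.rationalTateModule 3)) (r : FramedGaloisRep ℚ (PadicAlgCl 3) 4),
        TateFrame 3 B b r →
        (∀ g : Field.absoluteGaloisGroup ℚ, ∃ P : Polynomial ℤ_[3],
            P.map (algebraMap ℤ_[3] (PadicAlgCl 3)) = FramedRep.charpoly r g ∧
            P.map (PadicInt.toZMod (p := 3)) = FramedRep.charpoly ρb g) ∧
        ∀ (hcpt : isCompact_glFiniteIntegralLevel 4 ℚ) (ι : PadicAlgCl 3 ≃+* ℂ), AutGL4 3 hcpt ι r := by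
  intro h₂ hSup k _ _ _ _ _ σ σ' ρb hmodel hdet hsymp hshape hpeu htwo
  obtain ⟨B, hdim, ⟨e₃, he₃⟩, hss, hord₂, hfilt, e₂, him, hsurj, hcc⟩ :=
    hSup k σ σ' ρb hmodel hdet hsymp hshape hpeu htwo
  -- Thm. 8.3.2 (2-adic, residually A₅(b)): `B` is modular, for every `p`, in the summit's `GL₄` form
  have hmod := h₂ B hdim ⟨e₂, him, fun τ _ => hsurj τ, hcc⟩ hss hord₂
  -- `End_ℚ(B) = ℤ · 𝟙` from (d) alone (Lemma 8.1.1 / Schur + Zarhin 2000)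
  have hEnd : EndTrivial B := B.forall_end_eq_zsmul_id_of_s5bFrame e₂ fun τ _ => hsurj τ
  refine ⟨B, hdim, hfilt, hEnd, fun b r hr => ⟨?_, fun hcpt ι => ?_⟩⟩
  · exact bcgp_switch_charpolyClause B hdim ρb ⟨e₃, he₃⟩ b r hr
  · exact hmod 3 b r hr hcpt ι

/-! ## The SEMISTABLE SECTOR THEOREM modulo the lever (registered stub `stub_semistableSectorModuloLever`) -/

/-- **The crux on the semistable sector, modulo four published facts and the lever** (registered reshape stub of the
line `semistable-three-adic-anchor`; the sector predicate `SemistableSector` and the lever `TresRamifieSwitch` are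
INLINED verbatim, no new definition).  Facts, in the interface order of the landed `stub_bwSectorModuloFacts`: Faltings'
Finiteness I over `ℚ` (route gate item stmt-Langlands-15084; Satz 3/4 derived in-proof), the Serre–Tate ordinary
filtration (peu-ramifié case), the PRINTED BCGP `2`–`3` switch (peu-ramifié case), the Weil pairing; then THE LEVER — the
très-ramifié semistable switch (Yoshida-type `ρ̄` over `𝔽₃` that is an `𝔽₃`-model of the pair, symplectic-`ε̄⁻¹`,
ordinary-SHAPED at `3`, NOT peu ramifié at `3`, switchable at `2` ↦ an abelian surface `B/ℚ` with `V₃(B)` ordinary-FILTERED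
at `3`, `End_ℚ(B) = ℤ`, `H¹(B, ℚ̄₃)` congruent to `ρ̄` and MODULAR) — NOT in print.  Conclusion: `CruxAt p k red σ σ'`
at every datum with `p = 3`, `charpoly σ · charpoly σ'` `𝔽₃`-rational, and `σ, σ'` unramified at `2` with
`P₁ P₂ ≠ (X² ± X + 2)²`.  Proof: `exists_semistableSwitchable_model`; case split peu/très ramifié at `3` (printed switch +
`ordinaryReduction_tateModule_filtration`, resp. the lever) for a `B` with ordinary-filtered `V₃`; then `ρ₀ := framedH1 3 B b`
is symplectic-`ε⁻¹` (`isSymplectic_framedH1`), has residual pair `(σ, σ')` (`hasResidualPair_of_congruence`), is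
irreducible (`stub_tateModuleIrreducible_of`, Faltings via Finiteness I), Greenberg `(0,0,1,1)`
(`stub_greenbergOfOrdinaryFiltration`), residually `3`-distinguished (`stub_charpolyCongruence` +
`stub_distinguishedTransferLocal` from the H5-witness) and automorphic.
[cite: BoxerCalegariGeePilloni2025, Lemma 9.4.2, Lemma 9.4.1, §9.2, Thm. 8.3.2, Thm. 9.5.2 (arXiv:2502.20645)]
[cite: Faltings1983Endlichkeit, §5 Satz 3–4, §6 Satz 5–6] [cite: SerreTate1968GoodReduction, §1] [cite: Greenberg1991, §2]
[cite: Serre1987, §2.4, §2.8 (peu/très ramifié)] -/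
theorem stub_semistableSectorModuloLever :
    FaltingsFinitenessI → ordinaryReduction_tateModule_filtration →
    bcgp_switch_exists_modular_abelianSurface → weilPairing_rationalTateModule →
    (∀ (k : Type) [Field k] [CharP k 3] [IsAlgClosed k] [TopologicalSpace k] [DiscreteTopology k]
      (σ σ' : FramedGaloisRep ℚ k 2) (ρb : FramedGaloisRep ℚ (ZMod 3) 4),
      IsModelOf ρb σ σ' → DetCond 3 σ σ' →
      ρb.IsSymplecticWithMultiplierFun (fun g => (((epsBar 3 g)⁻¹ : (ZMod 3)ˣ) : ZMod 3)) →
      (∀ v : HeightOneSpectrum (𝓞 ℚ), ((3 : ℕ) : 𝓞 ℚ) ∈ v.asIdeal → IsOrdinaryShapedAt 3 v ρb) →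
      ¬ (∀ v : HeightOneSpectrum (𝓞 ℚ), ((3 : ℕ) : 𝓞 ℚ) ∈ v.asIdeal → ModPGaloisRep.IsPeuRamifie (ρb.toLocal v)) →
      (∀ v : HeightOneSpectrum (𝓞 ℚ), ((2 : ℕ) : 𝓞 ℚ) ∈ v.asIdeal → IsSwitchableAtTwo 3 v ρb) →
      ∃ B : AbelianVariety ℚ,
        B.dim = 2 ∧
        (∀ v : HeightOneSpectrum (𝓞 ℚ), ((3 : ℕ) : 𝓞 ℚ) ∈ v.asIdeal → IsOrdinaryFilteredAt 3 B v) ∧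
        EndTrivial B ∧
        ∀ (b : Module.Basis (Fin 4) ℚ_[3] (B.rationalTateModule 3)) (r : FramedGaloisRep ℚ (PadicAlgCl 3) 4),
          TateFrame 3 B b r →
          (∀ g : Field.absoluteGaloisGroup ℚ, ∃ P : Polynomial ℤ_[3],
              P.map (algebraMap ℤ_[3] (PadicAlgCl 3)) = FramedRep.charpoly r g ∧
              P.map (PadicInt.toZMod (p := 3)) = FramedRep.charpoly ρb g) ∧
          ∀ (hcpt : isCompact_glFiniteIntegralLevel 4 ℚ) (ι : PadicAlgCl 3 ≃+* ℂ), AutGL4 3 hcpt ι r) →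
    ∀ (p : ℕ) [Fact p.Prime], p ≠ 2 → ∀ (k : Type) [Field k] [CharP k p] [IsAlgClosed k]
      [TopologicalSpace k] [DiscreteTopology k] (red : Valued.integer (PadicAlgCl p) →+* k)
      (σ σ' : FramedGaloisRep ℚ k 2),
      (p = 3 ∧
        (∀ g : Field.absoluteGaloisGroup ℚ, ∃ Q : Polynomial (ZMod p),
          Q.map (ZMod.castHom (dvd_refl p) k) = FramedRep.charpoly σ g * FramedRep.charpoly σ' g) ∧
        (∀ v : HeightOneSpectrum (𝓞 ℚ), ((2 : ℕ) : 𝓞 ℚ) ∈ v.asIdeal →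
          σ.IsUnramifiedAt v ∧ σ'.IsUnramifiedAt v ∧
          ∃ P₁ P₂ : Polynomial k, σ.HasFrobCharpolyAt v P₁ ∧ σ'.HasFrobCharpolyAt v P₂ ∧
            P₁ * P₂ ≠ (X ^ 2 + X + C 2) ^ 2 ∧ P₁ * P₂ ≠ (X ^ 2 - X + C 2) ^ 2)) →
      CruxAt p k red σ σ' := by
  intro hFI hST hBCGP hWeil hTres p _ hp k _ _ _ _ _ red σ σ' hsec hA hA' hirr hirr' hdet hnc hw hcpt ι
  obtain ⟨hp3, hrat, htwo⟩ := hsec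
  subst hp3
  obtain ⟨ρb, hsymp, hmodel, hord, htwo'⟩ :=
    exists_semistableSwitchable_model 3 hp k red σ σ' hrat htwo hirr hirr' hdet hnc hw
  obtain ⟨ρw, hShw⟩ := hw
  -- the switch: printed (peu ramifié: BCGP Lemma 9.4.2 + Thm 8.3.2, then Serre–Tate) or the lever (très ramifié)
  obtain ⟨B, hdim, hfilt, hEnd, hH1⟩ : ∃ B : AbelianVariety ℚ,
      B.dim = 2 ∧
      (∀ v : HeightOneSpectrum (𝓞 ℚ), ((3 : ℕ) : 𝓞 ℚ) ∈ v.asIdeal → IsOrdinaryFilteredAt 3 B v) ∧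
      EndTrivial B ∧
      ∀ (b : Module.Basis (Fin 4) ℚ_[3] (B.rationalTateModule 3)) (r : FramedGaloisRep ℚ (PadicAlgCl 3) 4),
        TateFrame 3 B b r →
        (∀ g : Field.absoluteGaloisGroup ℚ, ∃ P : Polynomial ℤ_[3],
            P.map (algebraMap ℤ_[3] (PadicAlgCl 3)) = FramedRep.charpoly r g ∧
            P.map (PadicInt.toZMod (p := 3)) = FramedRep.charpoly ρb g) ∧
        ∀ (hcpt : isCompact_glFiniteIntegralLevel 4 ℚ) (ι : PadicAlgCl 3 ≃+* ℂ), AutGL4 3 hcpt ι r := by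
    by_cases hpeu : ∀ v : HeightOneSpectrum (𝓞 ℚ), ((3 : ℕ) : 𝓞 ℚ) ∈ v.asIdeal →
        ModPGaloisRep.IsPeuRamifie (ρb.toLocal v)
    · obtain ⟨B, hdim, hgood, hEnd, hH1⟩ := hBCGP ρb hsymp (fun v hv => ⟨hpeu v hv, hord v hv⟩) htwo'
      exact ⟨B, hdim, fun v hv => hST B v 3 hv (hgood v hv), hEnd, fun b r hfr => hH1 b r hfr⟩
    · exact hTres k σ σ' ρb hmodel hdet hsymp hord hpeu htwo'
  have hrank : Module.finrank ℚ_[3] (B.rationalTateModule 3) = 4 := by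
    rw [B.finrank_rationalTateModule_eq_holds 3 (natCast_prime_ne_zero_rat 3), hdim]
  haveI : Module.Finite ℚ_[3] (B.rationalTateModule 3) :=
    Module.finite_of_finrank_pos (by rw [hrank]; norm_num)
  let b : Module.Basis (Fin 4) ℚ_[3] (B.rationalTateModule 3) :=
    Module.finBasisOfFinrankEq ℚ_[3] _ hrank
  -- `ρ₀ := H¹_ét(B_ℚ̄, ℚ̄₃)` framed in the dual basis of `b`
  have hfr : TateFrame 3 B b (framedH1 3 B b) := tateFrame_framedH1 3 B b
  obtain ⟨hcong, hAut⟩ := hH1 b (framedH1 3 B b) hfr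
  have hunr : ∀ᶠ v : HeightOneSpectrum (𝓞 ℚ) in Filter.cofinite, (framedH1 3 B b).IsUnramifiedAt v := by
    obtain ⟨π, -, hπ⟩ := hAut hcpt ι
    exact hπ.mono fun v ⟨a, _, h, _⟩ => h
  have hsymp₀ := isSymplectic_framedH1 3 hWeil B b
  have hpair : (framedH1 3 B b).HasResidualPair red σ σ' :=
    hasResidualPair_of_congruence red hmodel hcong hunr
  have hirr₀ : (framedH1 3 B b).toGaloisRep.IsIrreducible :=
    stub_tateModuleIrreducible_of 3 B (faltings_tate_bijective_of_finitenessI hFI 3 B)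
      (isSemisimpleRepresentation_rationalTateRep_of_finitenessI hFI 3 B) b (framedH1 3 B b) hfr hEnd
  have hGr₀ : ∀ v : HeightOneSpectrum (𝓞 ℚ), ((3 : ℕ) : 𝓞 ℚ) ∈ v.asIdeal →
      (framedH1 3 B b).IsGreenbergOrdinaryOfShapeAt v ![0, 0, 1, 1] :=
    fun v hv => stub_greenbergOfOrdinaryFiltration 3 B b (framedH1 3 B b) hfr hdim v hv (hfilt v hv)
  refine ⟨framedH1 3 B b, hirr₀, ⟨hsymp₀, fun v hv => ⟨hGr₀ v hv, ?_⟩, hpair⟩, hAut hcpt ι⟩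
  exact stub_distinguishedTransferLocal 3 hp k red ρw (framedH1 3 B b) v hv
    (stub_charpolyCongruence 3 k red σ σ' ρw (framedH1 3 B b) hShw.2.2 hpair) (hShw.2.1 v hv).2 (hGr₀ v hv)

end Summit.Langlands.Langlands.Cruxes.StableYoshidaCongruence.SemistableThreeAdicAnchor

end
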